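import Mathlib.LinearAlgebra.Quotient.Basic
import Mathlib.Algebra.Exact.Basic
import HarnessLib

/-!
# Milne 1999 §6 «Almost cartesian squares»: the definition, LEMMA 6.3 (three equivalent conditions) and LEMMA 6.4
# (quotients; pasting) (J. S. Milne, *Lefschetz motives and the Tate conjecture*, Compositio Math. 117 (1999), §6 pp. 66–67)

Family `hodge`, lane `lit-hodgefound` (Layer A3; seat `lit-hodgefound-p27`, generation 16, row g16-#8); topic
`Literature/NumberTheory/ComplexMultiplication` (kept with the seat's Milne-1999 series, whose §6 — THEOREM 6.1 `P = L ∩ S` — these lemmas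
serve), namespace `Literature.NumberTheory.ComplexMultiplication.AlmostCartesian`.  Pure algebra, self-contained (Mathlib only): ONE
definition with body (`IsAlmostCartesian`, a `structure … : Prop`) + THEOREMS; no named fact (D-0026, net debt 0).  Stated for modules over a
commutative ring `R` (Milne: abelian groups, the case `R = ℤ`).

THE PRINT.  [Milne1999] §6 p. 66 L32 – p. 67 L30 (held `paper:doi-10-1023-a-1000776613765` p0022–p0023), verbatim: «ALMOST CARTESIAN SQUARES.
We say that a commutative square of Abelian groups (6.1) [`N′ −γ→ N`, `α′ : N′ → M′`, `α : N → M`, `M′ −β→ M`] is almost Cartesian if all the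
maps are surjective and the map `N′ −(α′,γ)→ M′ ×_M N` is surjective, i.e., if `N′ −(α′,γ)→ M′ ⊕ N −(β − α)→ M` is exact.  LEMMA 6.3. For a
square (6.1) in which all the maps are surjective, the following conditions are equivalent: (a) the square is almost Cartesian; (b) the map
`Ker γ → Ker β` induced by `α′` is surjective; (c) the map `Ker α′ → Ker α` induced by `γ` is surjective.  Proof. Assume (a). If `β(m′) = 0`,
then the pair `(m′, 0)` maps to `0` in `M` and, therefore, is the image of an `n′ ∈ N′`, i.e., `m′` is the image of an element `n′ ∈ Ker(γ)`.
Hence (b) holds.  Assume (b). Suppose `β(m′) = α(n)`. Choose `n′` such that `γ(n′) = n`. Then `α′(n′) − m′ ∈ Ker(β)`, and so there exists an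
`x ∈ Ker(γ)` such that `α′(x) = α′(n′) − m′`. Now `α′(n′ − x) = m′`, `γ(n′ − x) = n`. Hence (a) holds.  This proves the equivalence of (a)
and (b), and the equivalence of (a) and (c) is proved symmetrically.  LEMMA 6.4. (a) Suppose the square (6.1) is almost Cartesian, and let
`N″ ⊂ Ker(γ)` and `M″ ⊂ Ker(β)` be such that `α′(N″) ⊂ M″`. Then [`N′/N″ −γ̄→ N`, `ᾱ′ : N′/N″ → M′/M″`, `α`, `M′/M″ −β̄→ M`] is almost
Cartesian.  (b) If both inner squares in the diagram [`N″ −γ′→ N′ −γ→ N` over `M″ −β′→ M′ −β→ M`, vertical `α″`, `α′`, `α`] are almost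
Cartesian, then so also is the outer square.  Proof. (a) The composite `Ker(α′) → Ker(ᾱ′) → Ker(α)` is surjective, and so therefore is
`Ker(ᾱ′) → Ker(α)`.  (b) Both maps `Ker(α″) → Ker(α′) → Ker(α)` are surjective, and so therefore is their composite.»

DICTIONARY.  The square (6.1) is given by four linear maps `α′ : N′ → M′`, `γ : N′ → N`, `β : M′ → M`, `α : N → M` with `β ∘ α′ = α ∘ γ`;
`IsAlmostCartesian α′ γ β α` records commutativity, the four surjectivities, and the lifting property «`N′ → M′ ×_M N` is surjective»
(`∀ m′ n, β m′ = α n → ∃ n′, α′ n′ = m′ ∧ γ n′ = n`); `isAlmostCartesian_iff_exact` is Milne's «i.e.» (exactness of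
`N′ → M′ ⊕ N → M`, Mathlib `Function.Exact`); the induced maps on kernels are `kerMap` (`Ker γ → Ker β` by `α′`; `Ker α′ → Ker α` by `γ` is
the same construction for the transposed square); the quotient square of 6.4 (a) uses Mathlib's `Submodule.mapQ`/`liftQ`.
Lemma 6.4 is proved directly from the lifting property (a two-line diagram chase each) rather than through Lemma 6.3 as printed — the
statements are as printed.

WHAT IS HERE (all PROVED): DEF **`IsAlmostCartesian`**; `IsAlmostCartesian.symm` (transposition `(α′, γ, β, α) ↦ (γ, α′, α, β)`);
**`isAlmostCartesian_iff_exact`** (the «i.e.»); DEF `kerMap` (+ `coe_kerMap`); **LEMMA 6.3**: `IsAlmostCartesian.kerMap_surjective` ((a) ⇒ (b)),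
`IsAlmostCartesian.of_kerMap_surjective` ((b) ⇒ (a)), **`isAlmostCartesian_iff_kerMap_surjective`** ((a) ⇔ (b)),
**`isAlmostCartesian_iff_kerMap_surjective'`** ((a) ⇔ (c)); **LEMMA 6.4 (a)** `IsAlmostCartesian.quotient`; **LEMMA 6.4 (b)**
`IsAlmostCartesian.comp`.

NOT here: the use in THEOREM 6.1 (`P^K = S^K ∩ L^K`), §6 «Some linear algebra» (Prop. 6.5) — later rows / Layer B (B5-09).

## References

* [Milne1999] J. S. Milne, *Lefschetz motives and the Tate conjecture*, Compositio Math. 117 (1999) 45–76 — §6 «Almost cartesian squares»,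
  Lemma 6.3, Lemma 6.4, pp. 66–67 (held `paper:doi-10-1023-a-1000776613765` p0022 L61–L95, p0023 L1–L80).

Provenance: lane `lit-hodgefound`, seat `lit-hodgefound-p27` gen 16 (agent `literature-prover-lit-hodgefound-p27-g16-0`), row g16-#8.
-/

set_option autoImplicit false

namespace Literature.NumberTheory.ComplexMultiplication

namespace AlmostCartesian

variable {R : Type*} [CommRing R]
variable {N' N M' M : Type*} [AddCommGroup N'] [AddCommGroup N] [AddCommGroup M'] [AddCommGroup M]
variable [Module R N'] [Module R N] [Module R M'] [Module R M]

/-- **An ALMOST CARTESIAN square** `N′ −γ→ N`, `α′ : N′ → M′`, `α : N → M`, `M′ −β→ M`: «a commutative square … is almost Cartesian if all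
the maps are surjective and the map `N′ −(α′,γ)→ M′ ×_M N` is surjective». [cite: Milne1999, §6 p. 66 («Almost cartesian squares»)] -/
structure IsAlmostCartesian (α' : N' →ₗ[R] M') (γ : N' →ₗ[R] N) (β : M' →ₗ[R] M) (α : N →ₗ[R] M) : Prop where
  /-- the square commutes: `β ∘ α′ = α ∘ γ` -/
  comm : ∀ n' : N', β (α' n') = α (γ n')
  /-- `α′` is onto -/
  surjective_left : Function.Surjective α'
  /-- `γ` is onto -/
  surjective_top : Function.Surjective γ
  /-- `β` is onto -/
  surjective_bottom : Function.Surjective β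
  /-- `α` is onto -/
  surjective_right : Function.Surjective α
  /-- `N′ → M′ ×_M N` is onto -/
  lift : ∀ (m' : M') (n : N), β m' = α n → ∃ n' : N', α' n' = m' ∧ γ n' = n

variable {α' : N' →ₗ[R] M'} {γ : N' →ₗ[R] N} {β : M' →ₗ[R] M} {α : N →ₗ[R] M}

/-- The transposed square `(γ, α′, α, β)` is almost cartesian when `(α′, γ, β, α)` is (the notion is symmetric in the two legs; this is how
«the equivalence of (a) and (c) is proved symmetrically»). [cite: Milne1999, §6 p. 67 Lemma 6.3 (proof, last line)] -/
theorem IsAlmostCartesian.symm (h : IsAlmostCartesian α' γ β α) : IsAlmostCartesian γ α' α β where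
  comm n' := (h.comm n').symm
  surjective_left := h.surjective_top
  surjective_top := h.surjective_left
  surjective_bottom := h.surjective_right
  surjective_right := h.surjective_bottom
  lift n m' e := by
    obtain ⟨n', h1, h2⟩ := h.lift m' n e.symm
    exact ⟨n', h2, h1⟩

/-- **«i.e., if `N′ −(α′,γ)→ M′ ⊕ N −(β − α)→ M` is exact»**: for a commutative square with all four maps surjective, almost cartesian ⟺ the
sequence `n′ ↦ (α′ n′, γ n′)`, `(m′, n) ↦ β m′ − α n` is exact at `M′ ⊕ N`. [cite: Milne1999, §6 p. 66 («Almost cartesian squares»)] -/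
theorem isAlmostCartesian_iff_exact (hc : ∀ n' : N', β (α' n') = α (γ n')) (h₁ : Function.Surjective α') (h₂ : Function.Surjective γ)
    (h₃ : Function.Surjective β) (h₄ : Function.Surjective α) :
    IsAlmostCartesian α' γ β α ↔
      Function.Exact (LinearMap.prod α' γ) ((β.comp (LinearMap.fst R M' N)) - (α.comp (LinearMap.snd R M' N))) := by
  constructor
  · intro h x
    constructor
    · intro hx
      have hx' : β x.1 = α x.2 := by
        have : β x.1 - α x.2 = 0 := hx
        exact sub_eq_zero.mp this
      obtain ⟨n', h1, h2⟩ := h.lift x.1 x.2 hx'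
      exact ⟨n', Prod.ext h1 h2⟩
    · rintro ⟨n', rfl⟩
      change β (α' n') - α (γ n') = 0
      rw [hc, sub_self]
  · intro h
    refine ⟨hc, h₁, h₂, h₃, h₄, fun m' n e => ?_⟩
    have h0 : ((β.comp (LinearMap.fst R M' N)) - (α.comp (LinearMap.snd R M' N))) (m', n) = 0 := by
      change β m' - α n = 0
      rw [e, sub_self]
    obtain ⟨n', hn'⟩ := (h (m', n)).mp h0
    exact ⟨n', congrArg Prod.fst hn', congrArg Prod.snd hn'⟩

/-- **The map `Ker γ → Ker β` induced by `α′`** (it lands in `Ker β` by commutativity; applied to the transposed square it is «the map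
`Ker α′ → Ker α` induced by `γ`»). [cite: Milne1999, §6 p. 67 Lemma 6.3 (b)(c)] -/
def kerMap (hc : ∀ n' : N', β (α' n') = α (γ n')) : LinearMap.ker γ →ₗ[R] LinearMap.ker β :=
  (α'.comp (LinearMap.ker γ).subtype).codRestrict (LinearMap.ker β) fun x => by
    rw [LinearMap.mem_ker, LinearMap.comp_apply, Submodule.subtype_apply, hc, (LinearMap.mem_ker.mp x.2), map_zero]

/-- Values of `kerMap`. [cite: Milne1999, §6 p. 67 Lemma 6.3 (b)] -/
@[simp] theorem coe_kerMap (hc : ∀ n' : N', β (α' n') = α (γ n')) (x : LinearMap.ker γ) :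
    ((kerMap hc x : LinearMap.ker β) : M') = α' (x : N') := rfl

/-- **LEMMA 6.3, (a) ⇒ (b)**: in an almost cartesian square `Ker γ → Ker β` is onto («If `β(m′) = 0`, then the pair `(m′, 0)` maps to `0` in
`M` and, therefore, is the image of an `n′ ∈ N′`»). [cite: Milne1999, §6 p. 67 Lemma 6.3] -/
theorem IsAlmostCartesian.kerMap_surjective (h : IsAlmostCartesian α' γ β α) : Function.Surjective (kerMap h.comm) := by
  rintro ⟨m', hm'⟩
  obtain ⟨n', h1, h2⟩ := h.lift m' 0 (by rw [map_zero]; exact LinearMap.mem_ker.mp hm')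
  exact ⟨⟨n', LinearMap.mem_ker.mpr h2⟩, Subtype.ext h1⟩

/-- **LEMMA 6.3, (b) ⇒ (a)**: a commutative square with all maps onto in which `Ker γ → Ker β` is onto is almost cartesian («Suppose
`β(m′) = α(n)`. Choose `n′` such that `γ(n′) = n`. Then `α′(n′) − m′ ∈ Ker(β)`, and so there exists an `x ∈ Ker(γ)` such that
`α′(x) = α′(n′) − m′`. Now `α′(n′ − x) = m′`, `γ(n′ − x) = n`»). [cite: Milne1999, §6 p. 67 Lemma 6.3] -/
theorem IsAlmostCartesian.of_kerMap_surjective (hc : ∀ n' : N', β (α' n') = α (γ n')) (h₁ : Function.Surjective α')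
    (h₂ : Function.Surjective γ) (h₃ : Function.Surjective β) (h₄ : Function.Surjective α)
    (hk : Function.Surjective (kerMap hc)) : IsAlmostCartesian α' γ β α := by
  refine ⟨hc, h₁, h₂, h₃, h₄, fun m' n e => ?_⟩
  obtain ⟨n', rfl⟩ := h₂ n
  have hmem : α' n' - m' ∈ LinearMap.ker β := by
    rw [LinearMap.mem_ker, map_sub, hc, e, sub_self]
  obtain ⟨x, hx⟩ := hk ⟨α' n' - m', hmem⟩
  have hx' : α' (x : N') = α' n' - m' := by
    have := congrArg (fun y : LinearMap.ker β => (y : M')) hx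
    simpa only [coe_kerMap] using this
  refine ⟨n' - x, ?_, ?_⟩
  · rw [map_sub, hx', sub_sub_cancel]
  · rw [map_sub, LinearMap.mem_ker.mp x.2, sub_zero]

/-- **LEMMA 6.3, (a) ⇔ (b).** [cite: Milne1999, §6 p. 67 Lemma 6.3] -/
theorem isAlmostCartesian_iff_kerMap_surjective (hc : ∀ n' : N', β (α' n') = α (γ n')) (h₁ : Function.Surjective α')
    (h₂ : Function.Surjective γ) (h₃ : Function.Surjective β) (h₄ : Function.Surjective α) :
    IsAlmostCartesian α' γ β α ↔ Function.Surjective (kerMap hc) :=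
  ⟨fun h => h.kerMap_surjective, IsAlmostCartesian.of_kerMap_surjective hc h₁ h₂ h₃ h₄⟩

/-- **LEMMA 6.3, (a) ⇔ (c)**: almost cartesian ⟺ `Ker α′ → Ker α` (induced by `γ`) is onto — «proved symmetrically», through the transposed
square. [cite: Milne1999, §6 p. 67 Lemma 6.3] -/
theorem isAlmostCartesian_iff_kerMap_surjective' (hc : ∀ n' : N', β (α' n') = α (γ n')) (h₁ : Function.Surjective α')
    (h₂ : Function.Surjective γ) (h₃ : Function.Surjective β) (h₄ : Function.Surjective α) :
    IsAlmostCartesian α' γ β α ↔ Function.Surjective (kerMap (α' := γ) (γ := α') (β := α) (α := β) fun n' => (hc n').symm) := by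
  rw [← isAlmostCartesian_iff_kerMap_surjective (fun n' => (hc n').symm) h₂ h₁ h₄ h₃]
  exact ⟨IsAlmostCartesian.symm, IsAlmostCartesian.symm⟩

/-! ### LEMMA 6.4 -/

/-- **LEMMA 6.4 (a): quotients.**  For an almost cartesian square and submodules `N″ ⊆ Ker γ`, `M″ ⊆ Ker β` with `α′(N″) ⊆ M″`, the square
`N′/N″ −γ̄→ N`, `ᾱ′ : N′/N″ → M′/M″`, `α`, `M′/M″ −β̄→ M` of induced maps (Mathlib `Submodule.mapQ`, `Submodule.liftQ`) is almost cartesian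
(here by a direct chase: lift a representative). [cite: Milne1999, §6 p. 67 Lemma 6.4 (a)] -/
theorem IsAlmostCartesian.quotient (h : IsAlmostCartesian α' γ β α) (N'' : Submodule R N') (M'' : Submodule R M')
    (hN : N'' ≤ LinearMap.ker γ) (hM : M'' ≤ LinearMap.ker β) (hNM : N'' ≤ M''.comap α') :
    IsAlmostCartesian (N''.mapQ M'' α' hNM) (N''.liftQ γ hN) (M''.liftQ β hM) α := by
  refine ⟨?_, ?_, ?_, ?_, h.surjective_right, ?_⟩
  · intro x
    induction x using Submodule.Quotient.induction_on with | H n' => ?_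
    rw [Submodule.mapQ_apply, Submodule.liftQ_apply, Submodule.liftQ_apply]
    exact h.comm n'
  · intro y
    induction y using Submodule.Quotient.induction_on with | H m' => ?_
    obtain ⟨n', rfl⟩ := h.surjective_left m'
    exact ⟨Submodule.Quotient.mk n', rfl⟩
  · intro n
    obtain ⟨n', rfl⟩ := h.surjective_top n
    exact ⟨Submodule.Quotient.mk n', rfl⟩
  · intro m
    obtain ⟨m', rfl⟩ := h.surjective_bottom m
    exact ⟨Submodule.Quotient.mk m', rfl⟩
  · intro y n e
    induction y using Submodule.Quotient.induction_on with | H m' => ?_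
    rw [Submodule.liftQ_apply] at e
    obtain ⟨n', h1, h2⟩ := h.lift m' n e
    exact ⟨Submodule.Quotient.mk n', by rw [Submodule.mapQ_apply, h1], by rw [Submodule.liftQ_apply, h2]⟩

variable {N'' M'' : Type*} [AddCommGroup N''] [AddCommGroup M''] [Module R N''] [Module R M'']
variable {α'' : N'' →ₗ[R] M''} {γ' : N'' →ₗ[R] N'} {β' : M'' →ₗ[R] M'}

/-- **LEMMA 6.4 (b): pasting.**  If the squares `(α″, γ′, β′, α′)` (`N″ → N′` over `M″ → M′`) and `(α′, γ, β, α)` are almost cartesian, so is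
the outer square `(α″, γ ∘ γ′, β ∘ β′, α)` (here by chasing twice). [cite: Milne1999, §6 p. 67 Lemma 6.4 (b)] -/
theorem IsAlmostCartesian.comp (h' : IsAlmostCartesian α'' γ' β' α') (h : IsAlmostCartesian α' γ β α) :
    IsAlmostCartesian α'' (γ.comp γ') (β.comp β') α := by
  refine ⟨fun n'' => ?_, h'.surjective_left, h.surjective_top.comp h'.surjective_top, h.surjective_bottom.comp h'.surjective_bottom,
    h.surjective_right, fun m'' n e => ?_⟩
  · rw [LinearMap.comp_apply, LinearMap.comp_apply, h'.comm, h.comm]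
  · rw [LinearMap.comp_apply] at e
    obtain ⟨n', h1, h2⟩ := h.lift (β' m'') n e
    obtain ⟨n'', h3, h4⟩ := h'.lift m'' n' h1.symm
    exact ⟨n'', h3, by rw [LinearMap.comp_apply, h4, h2]⟩

end AlmostCartesian

end Literature.NumberTheory.ComplexMultiplication
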